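import Summits.CriticalPhenomena.PercolationContinuityZ3.Theorems.PercNearOneGluingNoHeavyLowerTailHullPortTASInduction
import Summits.CriticalPhenomena.PercolationContinuityZ3.Theorems.PercNearOneGluingNoHeavyLowerTailCovTauStarH
import HarnessLib

/-!
# `NoHeavyLowerTail` (stmt-CriticalPhenomena-4575) — owner-set `T_A ≥ 0` UNCONDITIONALLY: the (★^H)-at-a-singleton input
# from `CovTauStarN.starH_ED`, and (Htw) = the (K9)-diagonal of prim-hp-8's PROOF-S5-ALL-R (SOCKET P4)

Support file (prover `prim-hp-7`; `--supports stmt-CriticalPhenomena-4575`); no definitions, named facts or sorries.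
`…HullPortTASInduction` proves `HullPort.taQS_nonneg_of_starH` — the owner-set `T_A` functional is nonnegative — from the
single hypothesis `hStarH`: prim-hp-8's within-bound (★^H) (PROOF-S5-ALL-R (K7)) AT A SINGLETON SOURCE `{u}`, in the
`delE / cut / avoidEv` vocabulary of `…HullPortTADefs`.  prim-ineq-prove-1 proved (★^H) for every source set in the finitary
`ED / off / reached` vocabulary (`CovTauStarN.starH_ED`, …CovTauStarH.lean).  This file is the dictionary between the two
vocabularies (`ED univ = Σ_ω weight`, `off (reached univ {u} K) L = L ∖ cut_{u} K`, `nr S v = 1{v ↔ S}`,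
`1{x ∉ reached} = 1{x ↮ u}`, `covH(reached K) = taCS`, `yH({u}) = taBS`) and the conclusion:

* `HullPort.starHS_holds` — `hStarH` discharged;
* `HullPort.taQS_nonneg` — `0 ≤ taQS` for `x ∈ S`, `v ∉ S`, `g` monotone ≥ 0, all weights `< 1`, every avoided set `X`, every
  marker `o`: this is (Htw) `Σ_W μ(C_X = W)(p_W − p)·Cov_{G−W}(g(C_x), 1{v ↔ S}) ≥ 0` in cleared form (`× μ(v ↮ S∪X)²`), the
  (K9)-diagonal / Lemma H input of PROOF-S5-ALL-R §3.4, by prim-hp-7's induction instead of the two-source META-A2 (K8).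
[cite: Gladkov2024, Thm. 3.2 (p. 4)] [cite: VandenbergHaggstromKahn2005, Thms. 1.3–1.4 (pp. 6–7), §2.1 (pp. 9–13)]
-/

noncomputable section

namespace Summit.CriticalPhenomena.PercolationContinuityZ3.Theorems

open MeasureTheory Set Literature.Probability.LatticeModels Literature.Probability.Percolation
open scoped Classical

variable {V : Type*}

namespace HullPort

open LonePortSum LonePortSumGeneral BHK2006 DecisionTree KNPreFKG
open SetClusterExploration CovTauStarN

section TAS

variable [Fintype V]

/-! ### Dictionary between the `ED / off / reached` vocabulary (prim-ineq-prove-1) and `delE / cut / avoidEv` -/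

/-- `ED` over all pairs of a function of the coerced configuration is the `weight`-sum. [folklore] -/
theorem ED_univ_coe (q : Sym2 V → unitInterval) (φ : Set (Sym2 V) → ℝ) :
    ED Finset.univ (fun e => (q e : ℝ)) (fun K => φ ↑K) = ∑ ω, weight (fun e => (q e : ℝ)) ω * φ ω := by
  rw [← integral_eq_ED, integral_prodBernoulli_eq_sum]

/-- The world outside the explored cluster of `{u}`: `off (reached univ {u} K) L = L ∖ cut_{u}(K)`. [folklore] -/
theorem coe_off_reached_singleton (u : V) (K L : Finset (Sym2 V)) :
    (↑(off (reached Finset.univ {u} K) L) : Set (Sym2 V)) = (↑L : Set (Sym2 V)) \ cut {u} (↑K : Set (Sym2 V)) := by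
  ext e
  rw [Finset.mem_coe, mem_off, Set.mem_sdiff, Finset.mem_coe]
  simp only [cut, Set.mem_setOf_eq, Set.mem_singleton_iff, mem_reached_iff, Finset.inter_univ, Finset.mem_singleton]
  constructor
  · rintro ⟨heL, hw⟩
    refine ⟨heL, ?_⟩
    rintro ⟨w, hwe, x, rfl, hxw⟩
    exact hw w hwe ⟨x, rfl, hxw⟩
  · rintro ⟨heL, hno⟩
    refine ⟨heL, fun w hwe ⟨s, hs, hsw⟩ => hno ⟨w, hwe, s, hs, hsw⟩⟩

/-- `nr S v = 1{v ↔ S}`. [folklore] -/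
theorem nr_toFinset_eq (S : Set V) (v : V) (L : Finset (Sym2 V)) :
    nr S.toFinset v L = ind (connS S v) (↑L : Set (Sym2 V)) := by
  unfold nr
  by_cases h : (↑L : Set (Sym2 V)) ∈ connS S v
  · rw [ind_of_mem h, ind_of_mem]
    obtain ⟨s, hs, hr⟩ := h
    exact ⟨s, Set.mem_toFinset.2 hs, hr.symm⟩
  · rw [ind_of_not_mem h, ind_of_not_mem]
    rintro ⟨s, hs, hr⟩
    exact h ⟨s, Set.mem_toFinset.1 hs, hr.symm⟩

omit [Fintype V] in
/-- `nr {u} v = 1{v ↔ u}`. [folklore] -/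
theorem nr_singleton_eq (u v : V) (L : Finset (Sym2 V)) :
    nr {u} v L = ind (openConn v u : Set (BondConfig V)) (↑L : Set (Sym2 V)) := by
  unfold nr
  by_cases h : (↑L : Set (Sym2 V)) ∈ (openConn v u : Set (BondConfig V))
  · rw [ind_of_mem h, ind_of_mem]
    exact ⟨u, Finset.mem_singleton_self u, (h : (openGraph _).Reachable v u).symm⟩
  · rw [ind_of_not_mem h, ind_of_not_mem]
    rintro ⟨s, hs, hr⟩
    rw [Finset.mem_singleton] at hs
    subst hs
    exact h hr.symm

/-- `1{x ∉ reached univ {u} K} = 1{x ↮ u}`. [folklore] -/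
theorem ind_not_reached_eq (x u : V) (K : Finset (Sym2 V)) :
    ind {L : Finset (Sym2 V) | x ∉ reached Finset.univ {u} L} K = ind (avoidEv x {u}) (↑K : Set (Sym2 V)) := by
  by_cases h : (↑K : Set (Sym2 V)) ∈ avoidEv x {u}
  · rw [ind_of_mem h, ind_of_mem]
    show x ∉ reached Finset.univ {u} K
    rw [mem_reached_iff, Finset.inter_univ]
    rintro ⟨s, hs, hsx⟩
    rw [Finset.mem_singleton] at hs
    subst hs
    exact h s rfl hsx.symm
  · rw [ind_of_not_mem h, ind_of_not_mem]
    intro h'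
    apply h
    intro t ht hxt
    rw [Set.mem_singleton_iff] at ht
    subst ht
    exact h' ((mem_reached_iff).2 ⟨t, Finset.mem_singleton_self t, by rw [Finset.inter_univ]; exact hxt.symm⟩)

/-- The world covariance `H` of prim-ineq-prove-1's `covH` at the explored cluster of `{u}` is `taCS` at `X = {u}`. [folklore] -/
theorem covH_reached_eq_taCS (q : Sym2 V → unitInterval) (g : Set (Sym2 V) → ℝ) (x : V) (S : Set V) (v u : V)
    (K : Finset (Sym2 V)) :
    covH Finset.univ (fun e => (q e : ℝ)) g x S.toFinset v (reached Finset.univ {u} K) =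
      taCS (fun e => (q e : ℝ)) x S v {u} g ↑K := by
  unfold covH fcl taCS delE
  have h1 : ∀ L : Finset (Sym2 V), (↑(off (reached Finset.univ {u} K) L) : Set (Sym2 V)) = ↑L \ cut {u} (↑K : Set (Sym2 V)) :=
    coe_off_reached_singleton u K
  simp only [h1, nr_toFinset_eq]
  rw [ED_univ_coe q (fun η => g (openEdgeCluster (η \ cut {u} ↑K) x) * ind (connS S v) (η \ cut {u} ↑K)),
    ED_univ_coe q (fun η => g (openEdgeCluster (η \ cut {u} ↑K) x)),
    ED_univ_coe q (fun η => ind (connS S v) (η \ cut {u} ↑K))]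

/-- `covH` at the empty world is the plain covariance `Cov(g(C_x), 1{v ↔ S})`. [folklore] -/
theorem covH_empty_eq (q : Sym2 V → unitInterval) (g : Set (Sym2 V) → ℝ) (x : V) (S : Set V) (v : V) :
    covH Finset.univ (fun e => (q e : ℝ)) g x S.toFinset v ∅ =
      delE (fun e => (q e : ℝ)) ∅ (fun η => g (openEdgeCluster η x) * ind (connS S v) η) -
        delE (fun e => (q e : ℝ)) ∅ (fun η => g (openEdgeCluster η x)) *
          delE (fun e => (q e : ℝ)) ∅ (ind (connS S v)) := by
  unfold covH fcl delE
  simp only [off_empty, nr_toFinset_eq, Set.sdiff_empty]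
  rw [ED_univ_coe q (fun η => g (openEdgeCluster η x) * ind (connS S v) η), ED_univ_coe q (fun η => g (openEdgeCluster η x)),
    ED_univ_coe q (fun η => ind (connS S v) η)]

/-- `Y^H({u}) = taBS` at `X = {u}`. [folklore] -/
theorem yH_singleton_eq_taBS (q : Sym2 V → unitInterval) (g : Set (Sym2 V) → ℝ) (x : V) (S : Set V) (v u : V) :
    yH Finset.univ (fun e => (q e : ℝ)) g x S.toFinset v {u} = taBS (fun e => (q e : ℝ)) x S v {u} g := by
  unfold yH taBS
  simp only [ind_not_reached_eq, covH_reached_eq_taCS]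
  exact ED_univ_coe q (fun ω => ind (avoidEv x {u}) ω * taCS (fun e => (q e : ℝ)) x S v {u} g ω)

/-- `E[1 − nr_S] = μ(v ↮ S)` in `delE` form. [folklore] -/
theorem ED_one_sub_nr_eq (q : Sym2 V → unitInterval) (S : Set V) (v : V) :
    ED Finset.univ (fun e => (q e : ℝ)) (fun K => 1 - nr S.toFinset v K) =
      delE (fun e => (q e : ℝ)) ∅ (ind (connS S v : Set (Set (Sym2 V)))ᶜ) := by
  unfold delE
  simp only [Set.sdiff_empty, nr_toFinset_eq]
  have h : ∀ K : Finset (Sym2 V), (1 : ℝ) - ind (connS S v) (↑K : Set (Sym2 V)) = ind (connS S v : Set (Set (Sym2 V)))ᶜ ↑K := by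
    intro K
    by_cases hK : (↑K : Set (Sym2 V)) ∈ connS S v
    · rw [ind_of_mem hK, ind_of_not_mem (Set.notMem_compl_iff.2 hK)]; ring
    · rw [ind_of_not_mem hK, ind_of_mem (Set.mem_compl hK)]; ring
  simp only [h]
  exact ED_univ_coe q (ind (connS S v : Set (Set (Sym2 V)))ᶜ)

/-- `E[(1 − nr_S)(1 − nr_{u})] = μ(v ↮ S) − μ(v ↮ S, v ↔ u)` in `delE` form. [folklore] -/
theorem ED_one_sub_nr_mul_eq (q : Sym2 V → unitInterval) (S : Set V) (v u : V) :
    ED Finset.univ (fun e => (q e : ℝ)) (fun K => (1 - nr S.toFinset v K) * (1 - nr {u} v K)) =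
      delE (fun e => (q e : ℝ)) ∅ (ind (connS S v : Set (Set (Sym2 V)))ᶜ) -
        delE (fun e => (q e : ℝ)) ∅ (ind ((connS S v : Set (Set (Sym2 V)))ᶜ ∩ openConn v u)) := by
  unfold delE
  simp only [Set.sdiff_empty, nr_toFinset_eq, nr_singleton_eq]
  rw [← Finset.sum_sub_distrib]
  have h : ∀ K : Finset (Sym2 V), ((1 : ℝ) - ind (connS S v) (↑K : Set (Sym2 V))) * (1 - ind (openConn v u : Set (BondConfig V)) ↑K) =
      ind (connS S v : Set (Set (Sym2 V)))ᶜ ↑K - ind ((connS S v : Set (Set (Sym2 V)))ᶜ ∩ openConn v u) ↑K := by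
    intro K
    rw [ind_inter]
    by_cases hK : (↑K : Set (Sym2 V)) ∈ connS S v
    · rw [ind_of_mem hK, ind_of_not_mem (Set.notMem_compl_iff.2 hK)]; ring
    · rw [ind_of_not_mem hK, ind_of_mem (Set.mem_compl hK)]
      by_cases hu : (↑K : Set (Sym2 V)) ∈ (openConn v u : Set (BondConfig V))
      · rw [ind_of_mem hu]; ring
      · rw [ind_of_not_mem hu]; ring
  simp only [h]
  rw [ED_univ_coe q (fun ω => ind (connS S v : Set (Set (Sym2 V)))ᶜ ω - ind ((connS S v : Set (Set (Sym2 V)))ᶜ ∩ openConn v u) ω)]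
  refine Finset.sum_congr rfl fun ω _ => ?_
  ring

/-- `μ(v ↮ S) > 0` in `delE` form when all weights are `< 1` and `v ∉ S` (the empty configuration). [folklore] -/
theorem delE_empty_ind_compl_connS_pos (q : Sym2 V → unitInterval) (hq : ∀ e, (q e : ℝ) < 1) (S : Set V) (v : V)
    (hvS : v ∉ S) : 0 < delE (fun e => (q e : ℝ)) ∅ (ind (connS S v : Set (Set (Sym2 V)))ᶜ) := by
  have hw0 : ∀ e, 0 ≤ (q e : ℝ) := fun e => (q e).2.1
  have hw1 : ∀ e, (q e : ℝ) ≤ 1 := fun e => (hq e).le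
  unfold delE
  simp only [Set.sdiff_empty]
  have hmem : (∅ : Set (Sym2 V)) ∈ (connS S v : Set (Set (Sym2 V)))ᶜ := by
    rintro ⟨s, hs, hr⟩
    rw [reachable_empty_iff] at hr
    exact hvS (hr ▸ hs)
  calc 0 < weight (fun e => (q e : ℝ)) (∅ : Set (Sym2 V)) * ind (connS S v : Set (Set (Sym2 V)))ᶜ ∅ := by
        rw [ind_of_mem hmem, mul_one]; exact weight_empty_pos _ hq
    _ ≤ ∑ ω, weight (fun e => (q e : ℝ)) ω * ind (connS S v : Set (Set (Sym2 V)))ᶜ ω :=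
        Finset.single_le_sum (f := fun ω => weight (fun e => (q e : ℝ)) ω * ind (connS S v : Set (Set (Sym2 V)))ᶜ ω)
          (fun ω _ => mul_nonneg (weight_nonneg hw0 hw1 ω) (ind_nonneg _ _)) (Finset.mem_univ _)

/-- **(★^H) at a singleton source, in the `delE` vocabulary** — the hypothesis `hStarH` of `HullPort.taQS_nonneg_of_starH`,
from prim-ineq-prove-1's `CovTauStarN.starH_ED` (prim-hp-8 PROOF-S5-ALL-R (K7)): for `x ∈ S`, `v ∉ S`, `g` monotone
nonnegative, all weights `< 1`, every `u`:
`Σ_ω w 1{x↮u} Cov_{G − cut_u}(g(C_x), 1{v↔S}) ≤ μ(v↮u | v↮S) · Cov(g(C_x), 1{v↔S})`.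
[cite: Gladkov2024, Thm. 3.2 (p. 4)] [cite: VandenbergHaggstromKahn2005, Thm. 1.4 (p. 7), eq. (6) (p. 4)] -/
theorem starHS_holds (x : V) (S : Set V) (hxS : x ∈ S) (v : V) (hvS : v ∉ S) (g : Set (Sym2 V) → ℝ)
    (hg : Monotone g) (hg0 : ∀ C, 0 ≤ g C) (q : Sym2 V → unitInterval) (hq : ∀ e, (q e : ℝ) < 1) (u : V) :
    taBS (fun e => (q e : ℝ)) x S v {u} g ≤
      (1 - delE (fun e => (q e : ℝ)) ∅ (ind ((connS S v : Set (Set (Sym2 V)))ᶜ ∩ openConn v u)) /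
            delE (fun e => (q e : ℝ)) ∅ (ind (connS S v : Set (Set (Sym2 V)))ᶜ)) *
        (delE (fun e => (q e : ℝ)) ∅ (fun η => g (openEdgeCluster η x) * ind (connS S v) η) -
          delE (fun e => (q e : ℝ)) ∅ (fun η => g (openEdgeCluster η x)) *
            delE (fun e => (q e : ℝ)) ∅ (ind (connS S v))) := by
  have hp0 : ∀ e, 0 ≤ (q e : ℝ) := fun e => (q e).2.1
  have hp1 : ∀ e, (q e : ℝ) ≤ 1 := fun e => (q e).2.2
  have hxS' : x ∈ S.toFinset := Set.mem_toFinset.2 hxS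
  have hvS' : v ∉ S.toFinset := fun h => hvS (Set.mem_toFinset.1 h)
  have key := CovTauStarN.starH_ED Finset.univ hp0 hp1 {u} x v S.toFinset hvS' g hxS' hg hg0
  rw [yH_singleton_eq_taBS, ED_one_sub_nr_eq, ED_one_sub_nr_mul_eq, covH_empty_eq] at key
  set b := delE (fun e => (q e : ℝ)) ∅ (ind (connS S v : Set (Set (Sym2 V)))ᶜ) with hb
  set bW := delE (fun e => (q e : ℝ)) ∅ (ind ((connS S v : Set (Set (Sym2 V)))ᶜ ∩ openConn v u)) with hbW
  set H := delE (fun e => (q e : ℝ)) ∅ (fun η => g (openEdgeCluster η x) * ind (connS S v) η) -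
    delE (fun e => (q e : ℝ)) ∅ (fun η => g (openEdgeCluster η x)) * delE (fun e => (q e : ℝ)) ∅ (ind (connS S v)) with hH
  have hbpos : 0 < b := delE_empty_ind_compl_connS_pos q hq S v hvS
  have hfrac : (1 - bW / b) = (b - bW) / b := by field_simp
  rw [hfrac, div_mul_eq_mul_div, le_div_iff₀ hbpos]
  linarith [key]


/-- **(Htw) / the (K9)-diagonal of prim-hp-8's PROOF-S5-ALL-R, UNCONDITIONALLY, in cleared form**: for `x ∈ S`, `v ∉ S`,
`g` monotone nonnegative on edge sets, all weights `< 1`, every avoided set `X` and every marker `o`,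
`0 ≤ taQS = A·b − a·B = μ(v↮S∪X)·Σ_W μ(C_X=W)(p_W − p)·Cov_{G−W}(g(C_x), 1{v↔S})·μ(v↮S∪X)` (owner-set `T_A ≥ 0`).
Proof: `taQS_nonneg_of_starH` (prim-hp-7's double induction) fed with `starHS_holds` (prim-hp-8's (K7) at singletons,
prim-ineq-prove-1's `CovTauStarN.starH_ED`). [cite: Gladkov2024, Thm. 3.2 (p. 4)]
[cite: VandenbergHaggstromKahn2005, Thms. 1.3–1.4 (pp. 6–7), §2.1 (pp. 9–13)] -/
theorem taQS_nonneg (x : V) (S : Set V) (hxS : x ∈ S) (v : V) (hvS : v ∉ S) (g : Set (Sym2 V) → ℝ)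
    (hg : Monotone g) (hg0 : ∀ C, 0 ≤ g C) (w : Sym2 V → unitInterval) (hw : ∀ e, (w e : ℝ) < 1) (X : Set V) (o : V) :
    0 ≤ taQS (fun e => (w e : ℝ)) x S v o X g :=
  taQS_nonneg_of_starH x S v hvS g (fun q hq u => starHS_holds x S hxS v hvS g hg hg0 q hq u) w hw X o

end TAS

end HullPort

end Summit.CriticalPhenomena.PercolationContinuityZ3.Theorems
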